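import Summits.ResolutionOfSingularities.ResolutionOfSingularities.Theorems.HilbertSamuelEliminationSigmaMaxModificationsReduction
import Literature.AlgebraicGeometry.Morphisms.NagataCompactification
import HarnessLib

/-!
# `SigmaMaxModifications` (crux stmt-ResolutionOfSingularities-18506, route HilbertSamuelElimination)
— line `pointed-reduction` (crux-strategist, 2026-08-17): GLOBALISATION FOR FREE

**Crux.** For every prime `p`, field `k` of characteristic `p`, reduced separated finite-type
`X/k` which is not regular and every `N ≥ dim X` there is a `Σ^max`-modification of `X` at level
`N` (CJS, LNM 2270, Def. 6.15 in modification form). Inline `H^N` = `Scheme.hsFun` (`rfl`),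
`X_max = Scheme.hsMaxLocus X N`, `Σ_X = Scheme.hsValues X N`.

**Idea (card `pointed-reduction-generic-fibres`, ideator k1, sharpened here).** The crux is
equivalent to its POINTED case — the same statement for those `X` whose Hilbert–Samuel locus
`X_max` (closed: lead's `stub_isClosed_hsMaxLocus_over_field`) is PROPER OVER `k` — by a
Temkin-style noetherian induction run in Hilbert–Samuel currency, which needs NO canonicity,
NO functoriality and NO label ("year") bookkeeping (CJS Rem. 6.29 / Prop. 6.31), because the crux
accepts ANY proper `π` and asks monotonicity only END-TO-END:

* induction vehicle TF ("targeted filling"): for a closed `Z ⊆ X` and a locally constant target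
  `ν` on `Z` such that every `y ∉ Z` specialising into `Z` has `H(y) < ν`, there is a proper
  `Z`-cosupported `π` with dense preimage of `X ∖ Z` and `H < ν` at every point over `Z`
  (the crux is `Z = X_max`, `ν = H_X`; (ME2) + monotonicity ⟺ strict drop over `X_max`,
  refuter's `ME2_iff_forall_lt`);
* HORIZONTAL STEP at the generic point `τ` of a top-dimensional component of
  `T := closure (ρ (Z))` in the ORIGINAL scheme `X₀` (`ρ : X → X₀` the modification built so
  far), `w = dim closure(τ) ≥ 1`: the generic fibre `X_gen := ρ⁻¹(V₀) ×_{𝔸ʷ_k} Spec k(t)`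
  (`t` lifting a transcendence basis of `k(τ)`) is reduced, separated, of finite type over the
  field `k(t)`, of dimension `≤ d − w < d`, and STALK-ISOMORPHIC to `X` — same `H^N` at the SAME
  level `N` (`N ≥ d > d − w` stays admissible); TF in dimension `< d` (induction on `d`) gives a
  witness over `X_gen`, which SPREADS OUT (EGA IV §8: proper, reduced source, iso off `Z`,
  `H`-conditions and density are constructible conditions empty on the generic fibre) to a
  witness `π₂` over `W := ρ⁻¹(V₂)`, `V₂ ∋ τ` open in `X₀`;
* EXTENSION: glue `π₂` with the identity of `X ∖ closure(Z ∩ W)` along the iso-locus, a proper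
  morphism onto the open `X₃ := W ∪ (X ∖ closure(Z ∩ W))`, and COMPACTIFY it over `X` by
  NAGATA (`stub_nagata`, tree named fact `NagataCompactification`; replace `X̄'` by the reduced
  scheme-theoretic closure, so `X̄' ×_X X₃ = X'₃` because `X'₃ → X̄' ×_X X₃` is a proper open
  immersion with dense image): the GARBAGE over `F := closure(Z ∩ W) ∖ W ⊆ Z ∖ W` is arbitrary
  but lies over `T ∖ V₂ ⊊ T` — noetherian induction on `T`; the TF hypothesis for the new
  instance `(X̄', Z' := π̄⁻¹(Z ∖ W), ν)` is inherited (untouched points keep their local rings;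
  treated points over `Z ∩ W` have `H < ν`); no blow-up has to DOMINATE anything, so `H` is
  never pushed up (obstruction B-notes: joins / dominating modifications raise `H`);
* TERMINAL CASE `T` finite: `Z ⊆ ρ⁻¹(T)` is proper over `k`; on the open
  `X°° := X ∖ (closure{x ∉ Z : H x ≮ ν} ∪ ⋃ {H = μ : μ maximal, attained off Z})` (finitely many
  removals, `Σ` finite, `{H ≥ μ}` closed) the Hilbert–Samuel locus is CLOSED IN `X` and contained
  in `Z_bad ⊆ Z`, hence proper over `k`: the POINTED crux applies, the lead's gluing lemma
  `sigmaMaxModification_of_localWitness` extends by the identity, and iterating kills the bad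
  values in finitely many rounds by CJS Thm. 6.17 on bad-value sets (tree
  `Scheme.no_infinite_hsFun_tower`).

So `stub_pointed_reduction : Nagata → Pointed → SigmaMaxModifications` is UNCONDITIONAL scheme
theory (size L/XL in Lean: spreading out à la EGA IV §8 is the cost), and the open content of the
crux moves to the two POINTED open cores `stub_pointed_corridor3` / `stub_pointed_dim_ge_four` —
strictly weaker than the lead's `stub_dim_three_corridor` / `stub_dim_ge_four` (extra hypothesis:
`X_max` proper over `k`), i.e. LOCAL problems at finitely many closed points `y_j` of a finite-type
`X₀` (inside `ρ⁻¹(y_j)`; by formal glueing, inside `Spec` of the complete local rings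
`𝒪^_{X₀,y_j}` with coefficient fields — the arena of Cohen structure, CJS's key theorems 6.35/6.40
and Cossart–Piltant's local theory). Low dimensions are the lead's landed results (curves p156715,
surfaces p159874 from the CJS fact, isolated threefolds p154168 from the CP fact).

Stubs: `stub_nagata`, `stub_cjsSigmaMaxElimination`, `stub_cossartPiltant2019General` (known in
print; tree named facts), `stub_pointed_reduction` (provable, L/XL), `stub_pointed_corridor3`,
`stub_pointed_dim_ge_four` (OPEN). `SigmaMaxModifications_of` concludes the crux by name.
-/

set_option linter.dupNamespace false -- mandated namespace of this single-conjunct summit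

noncomputable section

open CategoryTheory AlgebraicGeometry TopologicalSpace Topology
open Literature.AlgebraicGeometry.Resolution Literature.RingTheory.HilbertSamuel
open Literature.AlgebraicGeometry.Morphisms (NagataCompactification)
open Summit.ResolutionOfSingularities.ResolutionOfSingularities.Theses.HilbertSamuelElimination
open Summit.ResolutionOfSingularities.ResolutionOfSingularities.Theorems.SigmaMaxModifications.Sketch

namespace Summit.ResolutionOfSingularities.ResolutionOfSingularities.Cruxes.SigmaMaxModifications.PointedReduction

/-! ## Known in print (named facts of the tree) -/

/-- **STUB (known in print): Nagata's compactification theorem** — every separated morphism of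
finite type to a qcqs scheme is an open immersion followed by a proper morphism (tree named fact
`Literature.AlgebraicGeometry.Morphisms.NagataCompactification`; Conrad 2007 Thm. 4.1, Stacks
0F41). Used ONCE, in the extension step of `stub_pointed_reduction`.
[cite: Conrad2007, Thm. 4.1] [cite: StacksProject, Tag 0F41] -/
theorem stub_nagata : NagataCompactification.{0} := by
  sorry

/-- **STUB (known in print): `Σ^max`-eliminations of reduced excellent surfaces** —
Cossart–Jannsen–Saito 2020, Thm. 6.28 with Thm. 3.10 (1) and Def. 6.14/6.15, the tree's named
fact `CossartJannsenSaito2020_sigmaMaxElimination` (as in the lead's line `Sketch`).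
[cite: CossartJannsenSaito2020, Thm. 6.28, Thm. 3.10 (1), Def. 6.15] -/
theorem stub_cjsSigmaMaxElimination : CossartJannsenSaito2020_sigmaMaxElimination.{0} := by
  sorry

/-- **STUB (known in print): Cossart–Piltant 2019, Thm. 1.1** — resolution of reduced
separated quasi-excellent threefolds, an isomorphism over the regular locus (tree named fact
`CossartPiltant2019General`, as in the lead's line `Sketch`). [cite: CossartPiltant2019, Thm. 1.1] -/
theorem stub_cossartPiltant2019General : CossartPiltant2019General.{0} := by
  sorry

/-! ## The reduction (provable: unconditional scheme theory) -/

/-- **STUB (provable, L/XL): POINTED REDUCTION — globalisation for free.** Assuming Nagata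
compactification: if the crux holds for every `X/k` (all primes, all fields, all dimensions, all
levels `N ≥ dim X`) whose Hilbert–Samuel locus `X_max`, with its reduced closed-subscheme
structure `(vanishingIdeal X_max).subscheme`, is PROPER over `k`, then the crux holds (conclusion written in the crux's `Scheme.hsFun` form, = the route decl by
`rfl`; only `SigmaMaxModifications_of` names the crux). Proof
sketch (module docstring): noetherian induction on `T = closure ρ(Z) ⊆ X₀` for the flexible
statement TF; horizontal step = TF in smaller dimension on the generic fibre over `k(t₁,…,t_w)`
(stalk-isomorphic, same level `N`) + spreading out (EGA IV §8) + gluing with the identity +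
Nagata over `X` (garbage over `T ∖ V₂ ⊊ T`); terminal step = the pointed crux on the open `X°°`
whose Hilbert–Samuel locus is the closed, proper bad locus + the lead's gluing lemma + CJS
Thm. 6.17 on bad-value sets. Cheapest falsifiers: (a) the level must not shift on the generic
fibre (it does not: same stalks, `dim X_gen ≤ d − w ≤ N`); (b) `X̄' ×_X X₃ = X'₃` for the reduced
closure of a Nagata compactification of the proper `X'₃ → X₃` (proper open immersion with dense
image); (c) the TF hypothesis is inherited by `(X̄', π̄⁻¹(Z ∖ W))`.
[cite: CossartJannsenSaito2020, Def. 6.15, Thm. 6.17, Lemma 6.30, Prop. 6.31]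
[cite: Temkin2008, Prop. 2.3.4 (the noetherian-induction pattern, regularity currency)]
[cite: Conrad2007, Thm. 4.1] -/
theorem stub_pointed_reduction :
    NagataCompactification.{0} →
    (∀ p : ℕ, p.Prime → ∀ (k : Type) [Field k] [CharP k p] (X : Scheme.{0})
      (f : X ⟶ Spec (.of k)), IsSeparated f → LocallyOfFiniteType f → QuasiCompact f →
      IsReduced X → ¬ Scheme.IsRegular X → ∀ N : ℕ, topologicalKrullDim X ≤ (N : WithBot ℕ∞) →
      ∀ hc : IsClosed (Scheme.hsMaxLocus X N),
      IsProper ((Scheme.IdealSheafData.vanishingIdeal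
        (⟨Scheme.hsMaxLocus X N, hc⟩ : Closeds X)).subschemeι ≫ f) →
        ∃ (X' : Scheme.{0}) (π : X' ⟶ X), IsProper π ∧ IsReduced X' ∧
          topologicalKrullDim X' ≤ (N : WithBot ℕ∞) ∧
          (∀ U : X.Opens, (U : Set X) ⊆ (Scheme.hsMaxLocus X N)ᶜ → IsIso (π ∣_ U)) ∧
          Dense ((fun x' => π.base x') ⁻¹' (Scheme.hsMaxLocus X N)ᶜ) ∧
          (∀ x' : X', Scheme.hsFun X' N x' ≤ Scheme.hsFun X N (π.base x')) ∧
          ∀ ν : ℕ → ℕ, Maximal (· ∈ Scheme.hsValues X N) ν → ν ∉ Scheme.hsValues X' N) →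
    ∀ p : ℕ, p.Prime → ∀ (k : Type) [Field k] [CharP k p] (X : Scheme.{0})
      (f : X ⟶ Spec (.of k)), IsSeparated f → LocallyOfFiniteType f → QuasiCompact f →
      IsReduced X → ¬ Scheme.IsRegular X → ∀ N : ℕ, topologicalKrullDim X ≤ (N : WithBot ℕ∞) →
        ∃ (X' : Scheme.{0}) (π : X' ⟶ X), IsProper π ∧ IsReduced X' ∧
          topologicalKrullDim X' ≤ (N : WithBot ℕ∞) ∧
          (∀ U : X.Opens, (U : Set X) ⊆ (Scheme.hsMaxLocus X N)ᶜ → IsIso (π ∣_ U)) ∧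
          Dense ((fun x' => π.base x') ⁻¹' (Scheme.hsMaxLocus X N)ᶜ) ∧
          (∀ x' : X', Scheme.hsFun X' N x' ≤ Scheme.hsFun X N (π.base x')) ∧
          ∀ ν : ℕ → ℕ, Maximal (· ∈ Scheme.hsValues X N) ν → ν ∉ Scheme.hsValues X' N := by
  sorry

/-! ## The pointed open cores -/

/-- **STUB (OPEN): the POINTED corridor case in dimension `3`.** For `X/k` reduced separated of
finite type, not regular, `dim X = 3 ≤ N`, whose Hilbert–Samuel locus `X_max` is PROPER OVER `k`
and MEETS `closure (Sing X ∖ X_max)`: a `Σ^max`-modification at level `N`. Strictly weaker than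
the lead's `stub_dim_three_corridor` (extra hypothesis: properness of `X_max`, i.e. the bad locus
lies over finitely many closed points of a finite-type model — a LOCAL problem in complete local
rings of dimension `≤ 3` with coefficient field, the arena of Cossart–Piltant's local
uniformization of `Spec S[Z]/(h)` and of CJS's key theorems; what is missing there in print is
CJS Thm. 6.28 without hypotheses (2) `dim X(ν̃) ≤ 1` and (3e) `ē_x ≤ 2` — "Thm. 6.40 for
`e = 3`" — and, for `p = 2` only, hypothesis (1) `char k(x) ≥ dim X/2 + 1`). Sharpest specimen:
`x³ + yz²w⁴ + yz⁴w² ⊂ 𝔸⁴_{𝔽₃}` at `N = 3` near the origin (refuter, `Negative/Levels`).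
[cite: CossartJannsenSaito2020, Rem. 6.29, Thm. 6.28, Thm. 6.35, Thm. 6.40]
[cite: CossartPiltant2019, §1] -/
theorem stub_pointed_corridor3 :
    ∀ p : ℕ, p.Prime → ∀ (k : Type) [Field k] [CharP k p] (X : Scheme.{0})
      (f : X ⟶ Spec (.of k)), IsSeparated f → LocallyOfFiniteType f → QuasiCompact f →
      IsReduced X → ¬ Scheme.IsRegular X → ((3 : ℕ) : WithBot ℕ∞) ≤ topologicalKrullDim X →
      topologicalKrullDim X ≤ 3 → ∀ N : ℕ, topologicalKrullDim X ≤ (N : WithBot ℕ∞) →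
      ∀ hc : IsClosed (Scheme.hsMaxLocus X N),
      IsProper ((Scheme.IdealSheafData.vanishingIdeal
        (⟨Scheme.hsMaxLocus X N, hc⟩ : Closeds X)).subschemeι ≫ f) →
      ¬ Disjoint (closure ((Scheme.regularLocus X)ᶜ \ Scheme.hsMaxLocus X N))
          (Scheme.hsMaxLocus X N) →
        ∃ (X' : Scheme.{0}) (π : X' ⟶ X), IsProper π ∧ IsReduced X' ∧
          topologicalKrullDim X' ≤ (N : WithBot ℕ∞) ∧
          (∀ U : X.Opens, (U : Set X) ⊆ (Scheme.hsMaxLocus X N)ᶜ → IsIso (π ∣_ U)) ∧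
          Dense ((fun x' => π.base x') ⁻¹' (Scheme.hsMaxLocus X N)ᶜ) ∧
          (∀ x' : X', Scheme.hsFun X' N x' ≤ Scheme.hsFun X N (π.base x')) ∧
          ∀ ν : ℕ → ℕ, Maximal (· ∈ Scheme.hsValues X N) ν → ν ∉ Scheme.hsValues X' N := by
  sorry

/-- **STUB (OPEN): the POINTED case from dimension `4` on.** For `X/k` reduced separated of
finite type, not regular, `4 ≤ dim X ≤ N`, whose Hilbert–Samuel locus `X_max` is PROPER OVER
`k`: a `Σ^max`-modification at level `N`. Strictly weaker than the lead's `stub_dim_ge_four`; it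
carries the whole difficulty of the programme (O1 for `p` small, O2 = no tertiary invariant of
Hironaka's polyhedra for `e ≥ 3`), but in LOCAL form: bare existence at a compact bad locus, so
non-canonical local constructions (weighted/face steps, arithmetic two-step blow-ups at wound
points, computer-found witnesses) are admissible contributions.
[cite: CossartJannsenSaito2020, Rem. 6.29, §1.3 (O1/O2)] [cite: Hironaka1964] -/
theorem stub_pointed_dim_ge_four :
    ∀ p : ℕ, p.Prime → ∀ (k : Type) [Field k] [CharP k p] (X : Scheme.{0})
      (f : X ⟶ Spec (.of k)), IsSeparated f → LocallyOfFiniteType f → QuasiCompact f →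
      IsReduced X → ¬ Scheme.IsRegular X → ((4 : ℕ) : WithBot ℕ∞) ≤ topologicalKrullDim X →
      ∀ N : ℕ, topologicalKrullDim X ≤ (N : WithBot ℕ∞) →
      ∀ hc : IsClosed (Scheme.hsMaxLocus X N),
      IsProper ((Scheme.IdealSheafData.vanishingIdeal
        (⟨Scheme.hsMaxLocus X N, hc⟩ : Closeds X)).subschemeι ≫ f) →
        ∃ (X' : Scheme.{0}) (π : X' ⟶ X), IsProper π ∧ IsReduced X' ∧
          topologicalKrullDim X' ≤ (N : WithBot ℕ∞) ∧
          (∀ U : X.Opens, (U : Set X) ⊆ (Scheme.hsMaxLocus X N)ᶜ → IsIso (π ∣_ U)) ∧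
          Dense ((fun x' => π.base x') ⁻¹' (Scheme.hsMaxLocus X N)ᶜ) ∧
          (∀ x' : X', Scheme.hsFun X' N x' ≤ Scheme.hsFun X N (π.base x')) ∧
          ∀ ν : ℕ → ℕ, Maximal (· ∈ Scheme.hsValues X N) ν → ν ∉ Scheme.hsValues X' N := by
  sorry

/-! ## Composition -/

/-- **The POINTED crux from the stubs** (graded by `dim X`, as in the lead's reduction): curves —
landed `stub_curve` ∘ `stub_curveResolution`; surfaces — landed `stub_surface_of_sigmaMaxFact`
from the CJS fact; `dim X = 3` isolated — landed `sigmaMaxModifications_dim_le_three_of_isolated`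
from the CP fact (the closedness of `X_max` is the pointed hypothesis `hc` itself); `dim X = 3`
corridor and `dim X ≥ 4` — the two pointed open cores. [cite: CossartJannsenSaito2020, Def. 6.15, Rem. 6.29] -/
theorem pointed_of_stubs :
    ∀ p : ℕ, p.Prime → ∀ (k : Type) [Field k] [CharP k p] (X : Scheme.{0})
      (f : X ⟶ Spec (.of k)), IsSeparated f → LocallyOfFiniteType f → QuasiCompact f →
      IsReduced X → ¬ Scheme.IsRegular X → ∀ N : ℕ, topologicalKrullDim X ≤ (N : WithBot ℕ∞) →
      ∀ hc : IsClosed (Scheme.hsMaxLocus X N),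
      IsProper ((Scheme.IdealSheafData.vanishingIdeal
        (⟨Scheme.hsMaxLocus X N, hc⟩ : Closeds X)).subschemeι ≫ f) →
        ∃ (X' : Scheme.{0}) (π : X' ⟶ X), IsProper π ∧ IsReduced X' ∧
          topologicalKrullDim X' ≤ (N : WithBot ℕ∞) ∧
          (∀ U : X.Opens, (U : Set X) ⊆ (Scheme.hsMaxLocus X N)ᶜ → IsIso (π ∣_ U)) ∧
          Dense ((fun x' => π.base x') ⁻¹' (Scheme.hsMaxLocus X N)ᶜ) ∧
          (∀ x' : X', Scheme.hsFun X' N x' ≤ Scheme.hsFun X N (π.base x')) ∧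
          ∀ ν : ℕ → ℕ, Maximal (· ∈ Scheme.hsValues X N) ν → ν ∉ Scheme.hsValues X' N := by
  intro p hp k _ _ X f hsep hft hqc hred hreg N hdim hc hprop
  rcases dim_trichotomy (topologicalKrullDim X) with h1 | ⟨h2, h2'⟩ | h3
  · -- curves (landed)
    exact stub_curve stub_curveResolution k X f hsep hft hqc hred hreg h1 N hdim
  · -- surfaces (landed, from the CJS fact)
    exact stub_surface_of_sigmaMaxFact stub_cjsSigmaMaxElimination k N
      (nat_le_of_le_dim_le h2 hdim) X f hsep hft hqc hred hreg h2' hdim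
  · by_cases h3' : topologicalKrullDim X ≤ ((3 : ℕ) : WithBot ℕ∞)
    · -- dimension exactly 3
      by_cases hdisj : Disjoint (closure ((Scheme.regularLocus X)ᶜ \ Scheme.hsMaxLocus X N))
          (Scheme.hsMaxLocus X N)
      · -- isolated (landed, from the CP fact)
        exact sigmaMaxModifications_dim_le_three_of_isolated stub_cossartPiltant2019General k X f
          hsep hft hqc hred hreg (by exact_mod_cast h3') N hdim hc hdisj
      · -- pointed corridor (open)
        exact stub_pointed_corridor3 p hp k X f hsep hft hqc hred hreg h3 (by exact_mod_cast h3')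
          N hdim hc hprop hdisj
    · -- dimension ≥ 4 (open)
      have h4 : ((4 : ℕ) : WithBot ℕ∞) ≤ topologicalKrullDim X := by
        rcases dim_le_or_succ_le (topologicalKrullDim X) 3 with h | h
        · exact absurd h h3'
        · exact h
      exact stub_pointed_dim_ge_four p hp k X f hsep hft hqc hred hreg h4 N hdim hc hprop

/-- **The crux from the stubs**: pointed reduction (with Nagata) applied to the pointed crux.
Concludes `SigmaMaxModifications` BY NAME. [cite: CossartJannsenSaito2020, Def. 6.15, Cor. 6.18] -/
theorem SigmaMaxModifications_of : SigmaMaxModifications := by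
  intro p hp k _ _ X f hsep hft hqc hred hreg N hdim
  -- the route decl's inline `H^N` / `X_max` / `Σ_X` are `Scheme.hsFun` / `hsMaxLocus` / `hsValues` by `rfl`
  exact stub_pointed_reduction stub_nagata pointed_of_stubs p hp k X f hsep hft hqc hred hreg N hdim

/-! ## Sanity: the crux trivially implies each pointed core (so the open stubs are WEAKER than
the lead's `stub_dim_three_corridor` / `stub_dim_ge_four`, not restatements of the crux) -/

/-- The crux implies the pointed `dim ≥ 4` core (drop the two extra hypotheses). [folklore] -/
theorem pointed_dim_ge_four_of_crux (h : SigmaMaxModifications) :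
    ∀ p : ℕ, p.Prime → ∀ (k : Type) [Field k] [CharP k p] (X : Scheme.{0})
      (f : X ⟶ Spec (.of k)), IsSeparated f → LocallyOfFiniteType f → QuasiCompact f →
      IsReduced X → ¬ Scheme.IsRegular X → ((4 : ℕ) : WithBot ℕ∞) ≤ topologicalKrullDim X →
      ∀ N : ℕ, topologicalKrullDim X ≤ (N : WithBot ℕ∞) →
      ∀ hc : IsClosed (Scheme.hsMaxLocus X N),
      IsProper ((Scheme.IdealSheafData.vanishingIdeal
        (⟨Scheme.hsMaxLocus X N, hc⟩ : Closeds X)).subschemeι ≫ f) →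
        ∃ (X' : Scheme.{0}) (π : X' ⟶ X), IsProper π ∧ IsReduced X' ∧
          topologicalKrullDim X' ≤ (N : WithBot ℕ∞) ∧
          (∀ U : X.Opens, (U : Set X) ⊆ (Scheme.hsMaxLocus X N)ᶜ → IsIso (π ∣_ U)) ∧
          Dense ((fun x' => π.base x') ⁻¹' (Scheme.hsMaxLocus X N)ᶜ) ∧
          (∀ x' : X', Scheme.hsFun X' N x' ≤ Scheme.hsFun X N (π.base x')) ∧
          ∀ ν : ℕ → ℕ, Maximal (· ∈ Scheme.hsValues X N) ν → ν ∉ Scheme.hsValues X' N := by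
  intro p hp k _ _ X f hsep hft hqc hred hreg _ N hdim _ _
  exact h p hp k X f hsep hft hqc hred hreg N hdim

end Summit.ResolutionOfSingularities.ResolutionOfSingularities.Cruxes.SigmaMaxModifications.PointedReduction

end
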